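import Summits.CriticalPhenomena.PercolationContinuityZ3.Theorems.Transplant.SkelNegBParamsResiduals
import HarnessLib

/-!
# N1 params, chain of record `NegB`, part RootValsY: THE y′-LEG OF THE ROOT RESIDUE AT THE LEDGER (RULING B.17, three legs) — the y′-run's window data
# (`KS.sLoY/sHiY/LaY`), the start half-width `KS.qY := W + 4RA′ + 3`, the origin shift `KS.Δ0 σu σ' := σu·4·n_L + σ'·v_L`, `KS.Δ1 := ⌊h_L·Δ0/n_L⌋`,
# `KS.yYof σu σ' yX := yX + (Δ0, Δ1)`, the last-core / region boxes of `yRunSched` (**`hlastcY_R`**, **`hregY_R`**), the stride count on the level axis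
# `KS.NyOf σ' y` with **`NyOf_spec`**, and the origin relations **`Λ₀of_yYof`** (`n_L·Λ₀(yY) = n_L·Λ₀(yX) + 4σu·n_L·m + σ'·v_L·m + v_L·ρ`, `ρ := (h_L·Δ0) mod n_L`),
# **`Λ₁of_yYof`** (`Λ₁(yY) = Λ₁(yX) − ρ`)

builds on p205010 (kernel theorem, internal audit signed; external expert review pending) — nothing in this file uses p205010; NOTHING is claimed about
the node `SamePDropOfSkeletonNeg₁` (OPEN).
Lane `prim-bschramm-*`, seat `prim-bschramm-stmt` (gen 14); helper file (`--supports stmt-CriticalPhenomena-4575 --as helper`); ledger HOME/prim-bschramm-stmt/NEG-PARAMS.md v0.13.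
[cite: KozmaNitzan2024, §4 p. 28 ((32) at the root), Lemma 11 (p. 22)] [cite: MartineauTassion2017, §3.2 (top pieces), §4.3 Lemma 4.2]
-/

noncomputable section

open scoped Classical

namespace Summit.CriticalPhenomena.PercolationContinuityZ3.Theorems.Transplant

namespace PlanarSkeletonNeg

namespace NegB

open Literature.Probability.Percolation Literature.Probability.LatticeModels SimpleGraph
open SkelConc (Consts)
open Skelφ (shearUnit shearUnit_pos yRunSched yPrmW)
open Skelφ.StepI (DataN)
open TwoAxis.Para (modulus)
open Neg

namespace KS

/-! ## §1 The y′-run's window data, start half-width, origin shift, boxes -/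

section Defs

variable (κ : Consts) {V : Type} [DecidableEq V] [Countable V] {G : SimpleGraph V} [G.LocallyFinite] (Φ : PlanarSkeletonNeg G) (t : V)
  (p : unitInterval) (D : DataN V) (g f mk : ℕ)

/-- The y′-stride's minimal along-progress in levels `⌊(n_Lℓ_L − U + 1)/U⌋` (`yPrmW.sLo`). [this work] -/
def sLoY : ℤ := ((nL κ Φ t p D g f : ℤ) * ℓL κ Φ t p D g f - (shearUnit (nL κ Φ t p D g f) (hL κ Φ t p D g f) : ℕ) + 1) / (shearUnit (nL κ Φ t p D g f) (hL κ Φ t p D g f) : ℕ)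

/-- The y′-stride's maximal along-progress `⌊n_Lℓ_L/U⌋ + 1` (`yPrmW.sHi`). [this work] -/
def sHiY : ℤ := (nL κ Φ t p D g f : ℤ) * ℓL κ Φ t p D g f / (shearUnit (nL κ Φ t p D g f) (hL κ Φ t p D g f) : ℕ) + 1

/-- The y′-link box's along half-size `3n_Lℓ_L/U + 1` (`yPrmW.La`). [this work] -/
def LaY : ℕ := 3 * (nL κ Φ t p D g f * ℓL κ Φ t p D g f) / shearUnit (nL κ Φ t p D g f) (hL κ Φ t p D g f) + 1

/-- **The y′-run's start half-width** `qY := W + 4RA′ + 3` (levels; the x-prefix's last core has level spread `±(W + 4RA′ + 1)`, the origin shift `< 1`). [this work] -/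
def qY : ℕ := Wrun κ Φ t p D g f + 4 * RA' κ Φ t p D mk + 3

/-- **The origin shift, abscissa**: `Δ0 := σu·4·n_L + σ'·v_L` (four x-strides, then centre the y′-window `[−(n+v), n−v]`). [this work] -/
def Δ0 (σu σ' : ℤ) : ℤ := σu * 4 * (nL κ Φ t p D g f : ℤ) + σ' * vL κ Φ t p D g f

/-- **The origin shift, ordinate**: `Δ1 := ⌊h_L·Δ0/n_L⌋` (keeps the shift's level `β′` in `(−n_L, 0]`). [this work] -/
def Δ1 (σu σ' : ℤ) : ℤ := hL κ Φ t p D g f * Δ0 κ Φ t p D g f σu σ' / (nL κ Φ t p D g f : ℤ)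

/-- The shift's level remainder `ρ := h_L·Δ0 − n_L·Δ1 = (h_L·Δ0) mod n_L`. [this work] -/
def ρY (σu σ' : ℤ) : ℤ := hL κ Φ t p D g f * Δ0 κ Φ t p D g f σu σ' - (nL κ Φ t p D g f : ℤ) * Δ1 κ Φ t p D g f σu σ'

/-- **THE y′-RUN ORIGIN** `yY := yX + (Δ0, Δ1)` (plain coordinates relative to the root). [this work] -/
def yYof (σu σ' : ℤ) (yX : Site 2) : Site 2 := yX + Skelφ.pt (Δ0 κ Φ t p D g f σu σ') (Δ1 κ Φ t p D g f σu σ')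

/-- Last core of the y′-run, transverse lower corner `(N+1)v_L − ((n_L+v_L)⁺ + (N+1)RA′)`. [this work] -/
def maLo (N : ℕ) : ℤ := ((N : ℤ) + 1) * vL κ Φ t p D g f - ((((nL κ Φ t p D g f : ℤ) + vL κ Φ t p D g f).toNat : ℤ) + ((N : ℤ) + 1) * RA' κ Φ t p D mk)

/-- Last core, transverse upper corner. [this work] -/
def maHi (N : ℕ) : ℤ := ((N : ℤ) + 1) * vL κ Φ t p D g f + ((((nL κ Φ t p D g f : ℤ) - vL κ Φ t p D g f).toNat : ℤ) + ((N : ℤ) + 1) * RA' κ Φ t p D mk)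

/-- Last core, level lower corner `(N+1)·sLo − qY − (N+1)RA′`. [this work] -/
def mbLo (qY' N : ℕ) : ℤ := ((N : ℤ) + 1) * sLoY κ Φ t p D g f - qY' - ((N : ℤ) + 1) * RA' κ Φ t p D mk

/-- Last core, level upper corner. [this work] -/
def mbHi (qY' N : ℕ) : ℤ := ((N : ℤ) + 1) * sHiY κ Φ t p D g f + qY' + ((N : ℤ) + 1) * RA' κ Φ t p D mk

/-- Region `k`, transverse lower corner `k·v_L − ((n_L+v_L)⁺ + k·RA′) − RA′ − n_L`. [this work] -/
def qaLo (k : ℕ) : ℤ := (k : ℤ) * vL κ Φ t p D g f - ((((nL κ Φ t p D g f : ℤ) + vL κ Φ t p D g f).toNat : ℤ) + (k : ℤ) * RA' κ Φ t p D mk) - RA' κ Φ t p D mk - nL κ Φ t p D g f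

/-- Region `k`, transverse upper corner. [this work] -/
def qaHi (k : ℕ) : ℤ := (k : ℤ) * vL κ Φ t p D g f + ((((nL κ Φ t p D g f : ℤ) - vL κ Φ t p D g f).toNat : ℤ) + (k : ℤ) * RA' κ Φ t p D mk) + RA' κ Φ t p D mk + nL κ Φ t p D g f

/-- Region `k`, level lower corner `k·sLo − qY − k·RA′ − RA′ − La`. [this work] -/
def qbLo (qY' k : ℕ) : ℤ := (k : ℤ) * sLoY κ Φ t p D g f - qY' - (k : ℤ) * RA' κ Φ t p D mk - RA' κ Φ t p D mk - LaY κ Φ t p D g f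

/-- Region `k`, level upper corner. [this work] -/
def qbHi (qY' k : ℕ) : ℤ := (k : ℤ) * sHiY κ Φ t p D g f + qY' + (k : ℤ) * RA' κ Φ t p D mk + RA' κ Φ t p D mk + LaY κ Φ t p D g f

/-- **`hlastcY`**: the y′-run's core `N + 1` is the box `[mbLo, mbHi] × [maLo, maHi]` (coordinate 0 = level, 1 = transverse). [folklore] -/
theorem hlastcY_R (hn : 1 ≤ nL κ Φ t p D g f) (hv : |vL κ Φ t p D g f| ≤ (nL κ Φ t p D g f : ℤ))
    (hlay : ((nL κ Φ t p D g f + (hL κ Φ t p D g f).natAbs : ℕ) : ℤ) ≤ (nL κ Φ t p D g f : ℤ) * ℓL κ Φ t p D g f + 1) (qY' N : ℕ) :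
    (yRunSched hn hv hlay (RA' κ Φ t p D mk) qY' N).core (N + 1) ⊆
      Finset.Icc (Skelφ.pt (mbLo κ Φ t p D g f mk qY' N) (maLo κ Φ t p D g f mk N)) (Skelφ.pt (mbHi κ Φ t p D g f mk qY' N) (maHi κ Φ t p D g f mk N)) := by
  intro y hy
  rw [Skelφ.yRunSched, Skelφ.mem_scheduleN_core_iff] at hy
  unfold ChainPara.RunPrm.InCore ChainPara.RunPrm.aLo ChainPara.RunPrm.aHi ChainPara.RunPrm.bLo ChainPara.RunPrm.bHi at hy
  simp only [Skelφ.yPrmW] at hy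
  rw [Skelφ.mem_Icc_pt_iff]
  unfold mbLo mbHi maLo maHi sLoY sHiY
  simp only [Nat.cast_add, Nat.cast_one] at hy ⊢
  obtain ⟨h1, h2, h3, h4⟩ := hy
  refine ⟨⟨by linarith, by linarith⟩, ⟨by linarith, by linarith⟩⟩

/-- **`hregY`**: the y′-run's region `k` is the box `[qbLo k, qbHi k] × [qaLo k, qaHi k]`. [folklore] -/
theorem hregY_R (hn : 1 ≤ nL κ Φ t p D g f) (hv : |vL κ Φ t p D g f| ≤ (nL κ Φ t p D g f : ℤ))
    (hlay : ((nL κ Φ t p D g f + (hL κ Φ t p D g f).natAbs : ℕ) : ℤ) ≤ (nL κ Φ t p D g f : ℤ) * ℓL κ Φ t p D g f + 1) (qY' N : ℕ) :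
    ∀ k ≤ N, (yRunSched hn hv hlay (RA' κ Φ t p D mk) qY' N).region k ⊆
      Finset.Icc (Skelφ.pt (qbLo κ Φ t p D g f mk qY' k) (qaLo κ Φ t p D g f mk k)) (Skelφ.pt (qbHi κ Φ t p D g f mk qY' k) (qaHi κ Φ t p D g f mk k)) := by
  intro k _ y hy
  rw [Skelφ.yRunSched, Skelφ.mem_scheduleN_region_iff] at hy
  unfold ChainPara.RunPrm.InRegion ChainPara.RunPrm.aLo ChainPara.RunPrm.aHi ChainPara.RunPrm.bLo ChainPara.RunPrm.bHi at hy
  simp only [Skelφ.yPrmW] at hy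
  rw [Skelφ.mem_Icc_pt_iff]
  unfold qbLo qbHi qaLo qaHi sLoY sHiY LaY
  simp only [Nat.cast_add, Nat.cast_one] at hy ⊢
  obtain ⟨h1, h2, h3, h4⟩ := hy
  refine ⟨⟨by linarith, by linarith⟩, ⟨by linarith, by linarith⟩⟩

/-- `U·sLo ≥ n_Lℓ_L − 2U + 2`, `U·sHi ≤ n_Lℓ_L + U`, `U·sHi ≥ n_Lℓ_L + 1`, `U·La ≤ 3n_Lℓ_L + U` (floor division). [folklore] -/
theorem sY_spec (hn : 1 ≤ nL κ Φ t p D g f) :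
    (nL κ Φ t p D g f : ℤ) * ℓL κ Φ t p D g f - 2 * (shearUnit (nL κ Φ t p D g f) (hL κ Φ t p D g f) : ℤ) + 2 ≤ (shearUnit (nL κ Φ t p D g f) (hL κ Φ t p D g f) : ℤ) * sLoY κ Φ t p D g f ∧
    (shearUnit (nL κ Φ t p D g f) (hL κ Φ t p D g f) : ℤ) * sHiY κ Φ t p D g f ≤ (nL κ Φ t p D g f : ℤ) * ℓL κ Φ t p D g f + shearUnit (nL κ Φ t p D g f) (hL κ Φ t p D g f) ∧
    (nL κ Φ t p D g f : ℤ) * ℓL κ Φ t p D g f + 1 ≤ (shearUnit (nL κ Φ t p D g f) (hL κ Φ t p D g f) : ℤ) * sHiY κ Φ t p D g f ∧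
    (shearUnit (nL κ Φ t p D g f) (hL κ Φ t p D g f) : ℤ) * (LaY κ Φ t p D g f : ℤ) ≤ 3 * ((nL κ Φ t p D g f : ℤ) * ℓL κ Φ t p D g f) + shearUnit (nL κ Φ t p D g f) (hL κ Φ t p D g f) := by
  have hU := shearUnit_pos hn (hL κ Φ t p D g f)
  obtain ⟨a1, a2⟩ := RootArith.floor_sandwich (x := (nL κ Φ t p D g f : ℤ) * ℓL κ Φ t p D g f - (shearUnit (nL κ Φ t p D g f) (hL κ Φ t p D g f) : ℕ) + 1) hU
  obtain ⟨b1, b2⟩ := RootArith.floor_sandwich (x := (nL κ Φ t p D g f : ℤ) * ℓL κ Φ t p D g f) hU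
  have hU' : 0 < shearUnit (nL κ Φ t p D g f) (hL κ Φ t p D g f) := by unfold Skelφ.shearUnit; omega
  have c1 := Nat.div_mul_le_self (3 * (nL κ Φ t p D g f * ℓL κ Φ t p D g f)) (shearUnit (nL κ Φ t p D g f) (hL κ Φ t p D g f))
  unfold sLoY sHiY LaY
  refine ⟨by linarith, by linarith, by linarith, ?_⟩
  push_cast
  have : ((3 * (nL κ Φ t p D g f * ℓL κ Φ t p D g f) / shearUnit (nL κ Φ t p D g f) (hL κ Φ t p D g f) * shearUnit (nL κ Φ t p D g f) (hL κ Φ t p D g f) : ℕ) : ℤ) ≤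
      ((3 * (nL κ Φ t p D g f * ℓL κ Φ t p D g f) : ℕ) : ℤ) := by exact_mod_cast c1
  push_cast at this
  nlinarith [this]

end Defs


/-! ## §2 The stride count on the level axis -/

section Count

variable (κ : Consts) {V : Type} [DecidableEq V] [Countable V] {G : SimpleGraph V} [G.LocallyFinite] (Φ : PlanarSkeletonNeg G) (t : V)
  (p : unitInterval) (D : DataN V) (g f : ℕ)

/-- **The y′-origin's fine ordinate** `F1c(y) := coarse c₁ (D/2) D (lam1 800 n_L h_L y)` (p3's literal). [this work] -/
def F1c (y : Site 2) : ℤ :=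
  TwoAxis.Para.coarse (20 * ((fcells κ Φ t p D g f).K : ℤ) * (((fcells κ Φ t p D g f).s 1 : ℕ) : ℤ))
    (Skelφ.NegPrm.Dof (nL κ Φ t p D g f) (hL κ Φ t p D g f) (ℓL κ Φ t p D g f) (vL κ Φ t p D g f) / 2) (Skelφ.NegPrm.Dof (nL κ Φ t p D g f) (hL κ Φ t p D g f) (ℓL κ Φ t p D g f) (vL κ Φ t p D g f))
    (TwoAxis.Para.lam1 800 (nL κ Φ t p D g f : ℤ) (hL κ Φ t p D g f) y)

/-- **THE y′-STRIDE COUNT** `Ny := round((800u₁ − σ'·F1c)/u₁) − 1`. [this work] -/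
def NyOf (σ' : ℤ) (y : Site 2) : ℕ := Int.toNat ((800 * u₁ κ Φ t p D g f - σ' * F1c κ Φ t p D g f y + u₁ κ Φ t p D g f / 2) / u₁ κ Φ t p D g f - 1)

/-- `F1c(y)` in the RootArith shape. [folklore] -/
theorem F1c_eq (y : Site 2) : F1c κ Φ t p D g f y = (800 * u₁ κ Φ t p D g f * (800 * Λ₁of κ Φ t p D g f y) + 640000 * modulus (nL κ Φ t p D g f) (hL κ Φ t p D g f) (vL κ Φ t p D g f) (Skelφ.NegPrm.vβOf (nL κ Φ t p D g f) (hL κ Φ t p D g f) (ℓL κ Φ t p D g f) (vL κ Φ t p D g f)) / 2) / (640000 * modulus (nL κ Φ t p D g f) (hL κ Φ t p D g f) (vL κ Φ t p D g f) (Skelφ.NegPrm.vβOf (nL κ Φ t p D g f) (hL κ Φ t p D g f) (ℓL κ Φ t p D g f) (vL κ Φ t p D g f))) := by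
  unfold F1c TwoAxis.Para.coarse
  rw [(units_eq κ Φ t p D g f).2.1, Dof_eq', (lam_eq κ Φ t p D g f y).2]

/-- **The y′-stride count is admissible and centred**: `1 + 3 + 1 + Ny ≤ 1000` and `|F1c + σ'u₁(Ny+1) − σ'·800u₁| ≤ u₁` whenever `|Λ₁(y)| ≤ 3m`. [folklore] -/
theorem NyOf_spec (hN : EqNumL κ Φ t p D g f) {σ' : ℤ} (hσ : σ' = 1 ∨ σ' = -1) (y : Site 2) (hΛ : |Λ₁of κ Φ t p D g f y| ≤ 3 * modulus (nL κ Φ t p D g f) (hL κ Φ t p D g f) (vL κ Φ t p D g f) (Skelφ.NegPrm.vβOf (nL κ Φ t p D g f) (hL κ Φ t p D g f) (ℓL κ Φ t p D g f) (vL κ Φ t p D g f))) :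
    0 + 1 + 3 + 1 + NyOf κ Φ t p D g f σ' y ≤ 1000 ∧
      |F1c κ Φ t p D g f y + σ' * u₁ κ Φ t p D g f * ((NyOf κ Φ t p D g f σ' y : ℤ) + 1) - σ' * 800 * u₁ κ Φ t p D g f| ≤ u₁ κ Φ t p D g f := by
  obtain ⟨hn1, hℓ1⟩ := one_le_of_eqNumL κ Φ t p D g f hN
  have hm : 0 < modulus (nL κ Φ t p D g f) (hL κ Φ t p D g f) (vL κ Φ t p D g f) (Skelφ.NegPrm.vβOf (nL κ Φ t p D g f) (hL κ Φ t p D g f) (ℓL κ Φ t p D g f) (vL κ Φ t p D g f)) := Skelφ.NegPrm.modulus_vβOf_pos hn1 hℓ1 _ _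
  have hu := (units_eq κ Φ t p D g f).2.2.2.2.2.2.2
  obtain ⟨f1, f2⟩ := RootArith.coarse_bounds (u := u₁ κ Φ t p D g f) (Λ := Λ₁of κ Φ t p D g f y) hm
  rw [← F1c_eq] at f1 f2
  set F := F1c κ Φ t p D g f y
  set u := u₁ κ Φ t p D g f
  set m := modulus (nL κ Φ t p D g f) (hL κ Φ t p D g f) (vL κ Φ t p D g f) (Skelφ.NegPrm.vβOf (nL κ Φ t p D g f) (hL κ Φ t p D g f) (ℓL κ Φ t p D g f) (vL κ Φ t p D g f))
  obtain ⟨hΛ1, hΛ2⟩ := abs_le.1 hΛ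
  have hFlo : -3 * u ≤ F := by
    by_contra hc; push Not at hc
    have h1 : 2 * m * F ≤ 2 * m * (-3 * u - 1) := mul_le_mul_of_nonneg_left (by linarith) (by positivity)
    nlinarith
  have hFhi : F ≤ 3 * u := by
    by_contra hc; push Not at hc
    have h1 : 2 * m * (3 * u + 1) ≤ 2 * m * F := mul_le_mul_of_nonneg_left (by linarith) (by positivity)
    nlinarith
  obtain ⟨d1, d2⟩ := RootArith.floor_sandwich (x := u) (d := 2) (by norm_num)
  have hu0 : 0 < u := by linarith
  obtain ⟨x1, x2⟩ := RootArith.floor_sandwich (x := 800 * u - σ' * F + u / 2) (d := u) hu0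
  set X := (800 * u - σ' * F + u / 2) / u
  have hσF : |σ' * F| ≤ 3 * u := by
    rcases hσ with rfl | rfl
    · rw [one_mul]; exact abs_le.2 ⟨by linarith, hFhi⟩
    · rw [neg_one_mul, abs_neg]; exact abs_le.2 ⟨by linarith, hFhi⟩
  obtain ⟨s1, s2⟩ := abs_le.1 hσF
  have hXlo : 796 ≤ X := by
    by_contra hc; push Not at hc
    have : u * X ≤ u * 795 := mul_le_mul_of_nonneg_left (by linarith) hu0.le
    nlinarith
  have hXhi : X ≤ 804 := by
    by_contra hc; push Not at hc
    have : u * 805 ≤ u * X := mul_le_mul_of_nonneg_left (by linarith) hu0.le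
    nlinarith
  have hNy : (NyOf κ Φ t p D g f σ' y : ℤ) = X - 1 := by
    show (Int.toNat ((800 * u - σ' * F + u / 2) / u - 1) : ℤ) = X - 1
    rw [Int.toNat_of_nonneg (by linarith)]
  constructor
  · have : ((0 + 1 + 3 + 1 + NyOf κ Φ t p D g f σ' y : ℕ) : ℤ) ≤ 1000 := by push_cast; rw [hNy]; linarith
    exact_mod_cast this
  · rw [hNy, abs_le]
    rcases hσ with rfl | rfl
    · simp only [one_mul] at x1 x2 ⊢
      constructor <;> nlinarith
    · simp only [neg_mul, one_mul, sub_neg_eq_add] at x1 x2 ⊢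
      constructor <;> nlinarith

end Count

/-! ## §3 The origin relations -/

section Origin

variable (κ : Consts) {V : Type} [DecidableEq V] [Countable V] {G : SimpleGraph V} [G.LocallyFinite] (Φ : PlanarSkeletonNeg G) (t : V)
  (p : unitInterval) (D : DataN V) (g f : ℕ)

/-- `0 ≤ ρ < n_L` (the remainder of `h_L·Δ0` by `n_L`). [folklore] -/
theorem ρY_bounds (hn : 1 ≤ nL κ Φ t p D g f) (σu σ' : ℤ) : 0 ≤ ρY κ Φ t p D g f σu σ' ∧ ρY κ Φ t p D g f σu σ' < nL κ Φ t p D g f := by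
  have hn0 : (0 : ℤ) < nL κ Φ t p D g f := by exact_mod_cast hn
  obtain ⟨a1, a2⟩ := RootArith.floor_sandwich (x := hL κ Φ t p D g f * Δ0 κ Φ t p D g f σu σ') (d := (nL κ Φ t p D g f : ℤ)) hn0
  unfold ρY Δ1
  constructor <;> linarith

/-- **`n_L·Λ₀(yY) = n_L·Λ₀(yX) + 4σu·n_L·m + σ'·v_L·m + v_L·ρ`** (the x-prefix of four strides and the `σ'·v_L` shift, read by the lattice functional).
[folklore] -/
theorem Λ₀of_yYof (σu σ' : ℤ) (yX : Site 2) :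
    (nL κ Φ t p D g f : ℤ) * Λ₀of κ Φ t p D g f (yYof κ Φ t p D g f σu σ' yX) =
      (nL κ Φ t p D g f : ℤ) * Λ₀of κ Φ t p D g f yX + 4 * σu * (nL κ Φ t p D g f : ℤ) * modulus (nL κ Φ t p D g f) (hL κ Φ t p D g f) (vL κ Φ t p D g f) (Skelφ.NegPrm.vβOf (nL κ Φ t p D g f) (hL κ Φ t p D g f) (ℓL κ Φ t p D g f) (vL κ Φ t p D g f)) + σ' * vL κ Φ t p D g f * modulus (nL κ Φ t p D g f) (hL κ Φ t p D g f) (vL κ Φ t p D g f) (Skelφ.NegPrm.vβOf (nL κ Φ t p D g f) (hL κ Φ t p D g f) (ℓL κ Φ t p D g f) (vL κ Φ t p D g f)) + vL κ Φ t p D g f * ρY κ Φ t p D g f σu σ' := by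
  unfold Λ₀of yYof ρY TwoAxis.Para.modulus
  simp only [Pi.add_apply, Skelφ.pt_zero, Skelφ.pt_one]
  unfold Δ0
  ring

/-- **`Λ₁(yY) = Λ₁(yX) − ρ`**. [folklore] -/
theorem Λ₁of_yYof (σu σ' : ℤ) (yX : Site 2) : Λ₁of κ Φ t p D g f (yYof κ Φ t p D g f σu σ' yX) = Λ₁of κ Φ t p D g f yX - ρY κ Φ t p D g f σu σ' := by
  unfold Λ₁of yYof ρY
  simp only [Pi.add_apply, Skelφ.pt_zero, Skelφ.pt_one]
  ring

/-- `|Λ₁(yY)| ≤ |Λ₁(yX)| + n_L`. [folklore] -/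
theorem abs_Λ₁of_yYof (hn : 1 ≤ nL κ Φ t p D g f) (σu σ' : ℤ) (yX : Site 2) : |Λ₁of κ Φ t p D g f (yYof κ Φ t p D g f σu σ' yX)| ≤ |Λ₁of κ Φ t p D g f yX| + nL κ Φ t p D g f := by
  rw [Λ₁of_yYof]
  obtain ⟨r1, r2⟩ := ρY_bounds κ Φ t p D g f hn σu σ'
  have := abs_sub (Λ₁of κ Φ t p D g f yX) (ρY κ Φ t p D g f σu σ')
  rw [abs_of_nonneg r1] at this
  linarith

/-- `|yY|₁ ≤ |yX|₁ + 55·n_L` (`|Δ0| ≤ 5n_L`, `|Δ1| ≤ 50n_L` under `|v_L| ≤ n_L`, `|h_L| ≤ 10n_L`). [folklore] -/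
theorem yYof_l1 (hn : 1 ≤ nL κ Φ t p D g f) (hv : |vL κ Φ t p D g f| ≤ (nL κ Φ t p D g f : ℤ)) (hκ : (hL κ Φ t p D g f).natAbs ≤ 10 * nL κ Φ t p D g f) {σu σ' : ℤ} (hσu : σu = 1 ∨ σu = -1) (hσ : σ' = 1 ∨ σ' = -1)
    (yX : Site 2) : (yYof κ Φ t p D g f σu σ' yX 0).natAbs + (yYof κ Φ t p D g f σu σ' yX 1).natAbs ≤ (yX 0).natAbs + (yX 1).natAbs + 55 * nL κ Φ t p D g f := by
  have hσu' : |σu| = 1 := by rcases hσu with h | h <;> simp [h]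
  have hσ'' : |σ'| = 1 := by rcases hσ with h | h <;> simp [h]
  have hκ' : |hL κ Φ t p D g f| ≤ 10 * (nL κ Φ t p D g f : ℤ) := by rw [← Int.natCast_natAbs]; exact_mod_cast hκ
  have hn0 : (0 : ℤ) < nL κ Φ t p D g f := by exact_mod_cast hn
  have hΔ0 : |Δ0 κ Φ t p D g f σu σ'| ≤ 5 * (nL κ Φ t p D g f : ℤ) := by
    unfold Δ0
    calc |σu * 4 * (nL κ Φ t p D g f : ℤ) + σ' * vL κ Φ t p D g f| ≤ |σu * 4 * (nL κ Φ t p D g f : ℤ)| + |σ' * vL κ Φ t p D g f| := abs_add_le _ _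
      _ = 4 * (nL κ Φ t p D g f : ℤ) + |vL κ Φ t p D g f| := by rw [abs_mul, abs_mul, hσu', one_mul, abs_mul, hσ'', one_mul, Nat.abs_cast]; norm_num
      _ ≤ 5 * (nL κ Φ t p D g f : ℤ) := by linarith
  have hΔ1 : |Δ1 κ Φ t p D g f σu σ'| ≤ 50 * (nL κ Φ t p D g f : ℤ) := by
    have hprod : |hL κ Φ t p D g f * Δ0 κ Φ t p D g f σu σ'| ≤ 10 * (nL κ Φ t p D g f : ℤ) * (5 * (nL κ Φ t p D g f : ℤ)) := by
      rw [abs_mul]; exact mul_le_mul hκ' hΔ0 (abs_nonneg _) (by positivity)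
    obtain ⟨p1, p2⟩ := abs_le.1 hprod
    obtain ⟨a1, a2⟩ := RootArith.floor_sandwich (x := hL κ Φ t p D g f * Δ0 κ Φ t p D g f σu σ') (d := (nL κ Φ t p D g f : ℤ)) hn0
    unfold Δ1
    rw [abs_le]; constructor
    · by_contra hc; push Not at hc
      have : (nL κ Φ t p D g f : ℤ) * (hL κ Φ t p D g f * Δ0 κ Φ t p D g f σu σ' / (nL κ Φ t p D g f : ℤ)) ≤ (nL κ Φ t p D g f : ℤ) * (-(50 * (nL κ Φ t p D g f : ℤ)) - 1) :=
        mul_le_mul_of_nonneg_left (by linarith) hn0.le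
      nlinarith
    · by_contra hc; push Not at hc
      have : (nL κ Φ t p D g f : ℤ) * (50 * (nL κ Φ t p D g f : ℤ) + 1) ≤ (nL κ Φ t p D g f : ℤ) * (hL κ Φ t p D g f * Δ0 κ Φ t p D g f σu σ' / (nL κ Φ t p D g f : ℤ)) :=
        mul_le_mul_of_nonneg_left (by linarith) hn0.le
      nlinarith
  have e : (((yYof κ Φ t p D g f σu σ' yX 0).natAbs + (yYof κ Φ t p D g f σu σ' yX 1).natAbs : ℕ) : ℤ) ≤ (((yX 0).natAbs + (yX 1).natAbs + 55 * nL κ Φ t p D g f : ℕ) : ℤ) := by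
    push_cast [Int.natCast_natAbs]
    unfold yYof; simp only [Pi.add_apply, Skelφ.pt_zero, Skelφ.pt_one]
    linarith [abs_add_le (yX 0) (Δ0 κ Φ t p D g f σu σ'), abs_add_le (yX 1) (Δ1 κ Φ t p D g f σu σ')]
  exact_mod_cast e

end Origin

end KS

end NegB

end PlanarSkeletonNeg

end Summit.CriticalPhenomena.PercolationContinuityZ3.Theorems.Transplant
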